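import Summits.AtomisticToContinuum.HydrodynamicLimit.Theorems.ImplosionDichotomyPolynomialCompressionUniquenessIdentity

/-!
# Commuting a spatial derivative past the frozen-coefficient linearised hard-sphere Euler operator

Helper file for the line `log-lipschitz-budget` of the crux
`ImplosionDichotomy.PolynomialCompression` (stub `stub_logBudgetShadowing`, energy method at
every derivative level). Fix ONE classical solution `V = (ρ, u, θ)` of the hard-sphere Euler
system on `[0, T) × 𝕋³` and `ζ` smooth on an open `J ⊇ ρ([0, T) × 𝕋³)`,
`A := θ (ζ(ρ) + ρ ζ'(ρ))/ρ`. The frozen-coefficient linearised operator `P_V` of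
`FrozenEnergyIdentity` (`hsEuler_frozen_energy_identity`) acts on jointly smooth
`W = (α, w, β)` by (`∂ₜ = Torus.timeDerivWithin (Ico 0 T)`, `∂ᵢ = Torus.partialDeriv i`)
`F_ρ W = ∂ₜα + Σᵢ uᵢ ∂ᵢα + ρ Σᵢ ∂ᵢwᵢ`, `(F_u W)ⱼ = ∂ₜwⱼ + Σᵢ uᵢ ∂ᵢwⱼ + A ∂ⱼα + ζ(ρ) ∂ⱼβ`,
`F_θ W = ∂ₜβ + Σᵢ uᵢ ∂ᵢβ + (2/3) θ ζ(ρ) Σᵢ ∂ᵢwᵢ`. For a direction `l` put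
`∂ₗW := (∂ₗα, ∂ₗw, ∂ₗβ)`, `∂ₗw` being the `V3`-valued partial derivative of the slices
`fun s => Torus.partialDeriv l (w s)` (its `j`-th coordinate is `∂ₗwⱼ`). The theorems of this
file are the pointwise ONE-STEP COMMUTATOR identities `P_V(∂ₗW) = ∂ₗ(P_V W) - C_l(V; ∂W)`:

* `hsEuler_frozen_commutator_density`: `F_ρ(∂ₗW) = ∂ₗ[F_ρ W] - (Σᵢ ∂ₗuᵢ ∂ᵢα + ∂ₗρ Σᵢ ∂ᵢwᵢ)`;
* `hsEuler_frozen_commutator_velocity`: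
  `(F_u(∂ₗW))ⱼ = ∂ₗ[(F_u W)ⱼ] - (Σᵢ ∂ₗuᵢ ∂ᵢwⱼ + ∂ₗA ∂ⱼα + ∂ₗ(ζ(ρ)) ∂ⱼβ)`;
* `hsEuler_frozen_commutator_temperature`:
  `F_θ(∂ₗW) = ∂ₗ[F_θ W] - (Σᵢ ∂ₗuᵢ ∂ᵢβ + (2/3) ∂ₗ(θ ζ(ρ)) Σᵢ ∂ᵢwᵢ)`,

where `∂ₗ[F …]` is `Torus.partialDeriv l` of the smooth function `y ↦ (F …)(t, y)`, written out.
`C_l` only involves FIRST derivatives of `u, ρ, A, ζ(ρ), θ ζ(ρ)` times first derivatives of `W`: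
the recursion generating the level-`k+1` energy estimate from level `k`. Ingredients:
(i) `∂ᵢ∂ₗ = ∂ₗ∂ᵢ` for smooth torus functions (`Torus.partialDeriv_comm`); (ii) the exchange
`∂ₜ∂ₗ = ∂ₗ∂ₜ` with the ONE-SIDED time derivative within a time set `S ⊆ closure (interior S)` of
unique differentiability (`torus_timeDerivWithin_partialDeriv_comm`, here `S = [0, T)`): both
sides are entries of the second derivative of the space–time lift within `S × ℝᵈ`, symmetric by
Mathlib's `ContDiffWithinAt.isSymmSndFDerivWithinAt` (the argument of
`Torus.timeDerivWithin_partialDeriv_comm` of `TorusInverseLaplacianCalculus`, stated there for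
closed slabs only); (iii) Leibniz along coordinate lines (`hasDerivAt_coordLine`,
`partialDeriv_eq_of_hasDerivAt`). No equation is used: `V` enters through smoothness and `ρ > 0`.
-/

noncomputable section

namespace Summit.AtomisticToContinuum.HydrodynamicLimit.Theorems

open Set Filter Topology MeasureTheory
open scoped ContDiff
open Literature.MathematicalPhysics.KineticTheory Literature.Analysis.FunctionSpaces

/-! ### Exchanging the one-sided time derivative with spatial partial derivatives -/

section Exchange

/-- **`∂ₜ∂ⱼ = ∂ⱼ∂ₜ` for jointly smooth fields, one-sided in time.** For a field `u` jointly smooth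
on `S × 𝕋ᵈ`, `S` a time set of unique differentiability contained in the closure of its interior
(any interval with nonempty interior, e.g. `Ico 0 T`), and `t ∈ S`, the one-sided time derivative
within `S` of the spatial partial derivative `∂ⱼu` is the spatial partial derivative of the
one-sided time derivative. Both sides are the entries `((1,0),(0,eⱼ))` resp. `((0,eⱼ),(1,0))` of
the second derivative of the space–time lift within `S × ℝᵈ`, which is symmetric
(`ContDiffWithinAt.isSymmSndFDerivWithinAt`). [folklore] -/
theorem torus_timeDerivWithin_partialDeriv_comm {d : Type*} [Fintype d] [DecidableEq d]
    {F : Type*} [NormedAddCommGroup F] [NormedSpace ℝ F] {S : Set ℝ}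
    {u : ℝ → UnitAddTorus d → F} (hu : Torus.IsSmoothSpaceTimeOn S u) (hS : UniqueDiffOn ℝ S)
    (hcl : S ⊆ closure (interior S)) {t : ℝ} (ht : t ∈ S) (j : d) (x : UnitAddTorus d) :
    Torus.timeDerivWithin S (fun s => Torus.partialDeriv j (u s)) t x =
      Torus.partialDeriv j (Torus.timeDerivWithin S u t) x := by
  -- adapted from `Torus.timeDerivWithin_partialDeriv_comm` (TorusInverseLaplacianCalculus, `Icc`)
  obtain ⟨y, rfl⟩ := Torus.proj_surjective x
  set S' : Set (ℝ × EuclideanSpace ℝ d) := S ×ˢ (univ : Set (EuclideanSpace ℝ d))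
  have hU : UniqueDiffOn ℝ S' := hS.prod uniqueDiffOn_univ
  have hty : (t, y) ∈ S' := mk_mem_prod ht (mem_univ y)
  set A : ℝ × EuclideanSpace ℝ d → (ℝ × EuclideanSpace ℝ d →L[ℝ] F) :=
    fderivWithin ℝ (Torus.stLift u) S'
  have hAdiff : ContDiffOn ℝ ∞ A S' := hu.fderivWithin hU le_rfl
  have hA_at : HasFDerivWithinAt A (fderivWithin ℝ A S' (t, y)) S' (t, y) :=
    (hAdiff.differentiableOn (by simp) (t, y) hty).hasFDerivWithinAt
  -- Schwarz within `S'` at `(t, y) ∈ closure (interior S')`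
  have hsymm : IsSymmSndFDerivWithinAt ℝ (Torus.stLift u) S' (t, y) := by
    refine (hu (t, y) hty).isSymmSndFDerivWithinAt ?_ hU ?_ hty
    · rw [minSmoothness_of_isRCLikeNormedField]
      exact WithTop.coe_le_coe.2 le_top
    · have h : (t, y) ∈ closure (interior S) ×ˢ (univ : Set (EuclideanSpace ℝ d)) :=
        mk_mem_prod (hcl ht) (mem_univ y)
      rw [interior_prod_eq, interior_univ, closure_prod_eq, closure_univ]
      exact h
  have key := hsymm.eq ((1 : ℝ), (0 : EuclideanSpace ℝ d))
    ((0 : ℝ), EuclideanSpace.single j (1 : ℝ))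
  -- slices: `∂ⱼ(u s)(proj y') = A (s, y') (0, eⱼ)`, `∂ₜu t (proj y') = A (t, y') (1, 0)`
  have e1 : ∀ s ∈ S, Torus.partialDeriv j (u s) (Torus.proj y) =
      A (s, y) ((0 : ℝ), EuclideanSpace.single j (1 : ℝ)) := by
    intro s hs
    rw [Torus.partialDeriv_eq_fderiv_apply ((hu.isSmooth_slice hs).isContDiff (by simp)),
      hu.fderiv_slice_apply hs y]
  have e2 : ∀ y' : EuclideanSpace ℝ d, Torus.timeDerivWithin S u t (Torus.proj y') =
      A (t, y') ((1 : ℝ), (0 : EuclideanSpace ℝ d)) :=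
    fun y' => hu.timeDerivWithin_apply_proj hS ht y'
  -- the left-hand side is `(D A (t, y) (1, 0)) (0, eⱼ)`
  have hL : Torus.timeDerivWithin S (fun s => Torus.partialDeriv j (u s)) t (Torus.proj y) =
      (fderivWithin ℝ A S' (t, y) ((1 : ℝ), (0 : EuclideanSpace ℝ d)))
        ((0 : ℝ), EuclideanSpace.single j (1 : ℝ)) := by
    unfold Torus.timeDerivWithin
    rw [derivWithin_congr (fun s hs => e1 s hs) (e1 t ht)]
    have h2 : HasDerivWithinAt (fun s' : ℝ => ((s', y) : ℝ × EuclideanSpace ℝ d))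
        ((1 : ℝ), (0 : EuclideanSpace ℝ d)) S t :=
      (hasDerivWithinAt_id t S).prodMk (hasDerivWithinAt_const t S y)
    have h3 : HasDerivWithinAt (fun s' => A (s', y))
        (fderivWithin ℝ A S' (t, y) ((1 : ℝ), (0 : EuclideanSpace ℝ d))) S t :=
      hA_at.comp_hasDerivWithinAt t h2 fun s' hs' => mk_mem_prod hs' (mem_univ y)
    have h4 : HasDerivWithinAt (fun s' => A (s', y) ((0 : ℝ), EuclideanSpace.single j (1 : ℝ)))
        ((fderivWithin ℝ A S' (t, y) ((1 : ℝ), (0 : EuclideanSpace ℝ d)))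
          ((0 : ℝ), EuclideanSpace.single j (1 : ℝ))) S t := by
      have h := h3.clm_apply (hasDerivWithinAt_const t S
        (((0 : ℝ), EuclideanSpace.single j (1 : ℝ)) : ℝ × EuclideanSpace ℝ d))
      simpa using h
    exact h4.derivWithin (hS t ht)
  -- the right-hand side is `(D A (t, y) (0, eⱼ)) (1, 0)`
  have hR : Torus.partialDeriv j (Torus.timeDerivWithin S u t) (Torus.proj y) =
      (fderivWithin ℝ A S' (t, y) ((0 : ℝ), EuclideanSpace.single j (1 : ℝ)))
        ((1 : ℝ), (0 : EuclideanSpace ℝ d)) := by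
    rw [Torus.partialDeriv_eq_fderiv_apply
      ((hu.isSmooth_timeDerivWithin hS ht).isContDiff (by simp)), ← Torus.fderiv_lift]
    have hfun : Torus.lift (Torus.timeDerivWithin S u t) =
        fun y' => A (t, y') ((1 : ℝ), (0 : EuclideanSpace ℝ d)) := by
      funext y'
      rw [Torus.lift_apply]
      exact e2 y'
    rw [hfun]
    have h2 : HasFDerivAt (fun y' : EuclideanSpace ℝ d => ((t, y') : ℝ × EuclideanSpace ℝ d))
        (ContinuousLinearMap.inr ℝ ℝ (EuclideanSpace ℝ d)) y :=
      hasFDerivAt_prodMk_right t y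
    have h3 : HasFDerivAt (fun y' => A (t, y'))
        ((fderivWithin ℝ A S' (t, y)).comp (ContinuousLinearMap.inr ℝ ℝ (EuclideanSpace ℝ d))) y :=
      hA_at.comp_hasFDerivAt y h2 (Eventually.of_forall fun y' => mk_mem_prod ht (mem_univ y'))
    have h4 : HasFDerivAt (fun y' => A (t, y') ((1 : ℝ), (0 : EuclideanSpace ℝ d)))
        (((fderivWithin ℝ A S' (t, y)).comp
          (ContinuousLinearMap.inr ℝ ℝ (EuclideanSpace ℝ d))).flip
            ((1 : ℝ), (0 : EuclideanSpace ℝ d))) y := by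
      have h := h3.clm_apply (hasFDerivAt_const
        (((1 : ℝ), (0 : EuclideanSpace ℝ d)) : ℝ × EuclideanSpace ℝ d) y)
      simpa using h
    rw [h4.fderiv]
    simp
  rw [hL, hR]
  exact key

/-- `∂ₜ∂ⱼ = ∂ⱼ∂ₜ` on `[0, T) × 𝕋³` for a jointly smooth scalar field, with the one-sided time
derivative within `Ico 0 T` of the solution notions (`torus_timeDerivWithin_partialDeriv_comm`
with `Ico 0 T ⊆ closure (interior (Ico 0 T)) = Icc 0 T`). [folklore] -/
theorem torus_timeDerivWithin_Ico_partialDeriv_comm :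
    ∀ {T : ℝ} {a : ℝ → T3 → ℝ}, Torus.IsSmoothSpaceTimeOn (Ico 0 T) a →
    ∀ {t : ℝ}, t ∈ Ico 0 T → ∀ (j : Fin 3) (x : T3),
    Torus.timeDerivWithin (Ico 0 T) (fun s => Torus.partialDeriv j (a s)) t x =
      Torus.partialDeriv j (Torus.timeDerivWithin (Ico 0 T) a t) x := by
  intro T a ha t ht j x
  have hT : (0 : ℝ) < T := ht.1.trans_lt ht.2
  have hcl : Ico (0 : ℝ) T ⊆ closure (interior (Ico (0 : ℝ) T)) := by
    rw [interior_Ico, closure_Ioo hT.ne]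
    exact Ico_subset_Icc_self
  exact torus_timeDerivWithin_partialDeriv_comm ha (uniqueDiffOn_Ico 0 T) hcl ht j x

end Exchange

/-! ### The three commutator identities -/

section Commutator

/-- **One-step commutator, density component.** For a classical hard-sphere–Euler solution
`(ρ, u, θ)` on `[0, T) × 𝕋³`, jointly smooth fields `α` (scalar) and `w` (vector) on
`[0, T) × 𝕋³` and a direction `l`, the density component
`F_ρ(α, w) = ∂ₜα + Σᵢ uᵢ ∂ᵢα + ρ Σᵢ ∂ᵢwᵢ` of the frozen-coefficient linearised operator satisfies
`F_ρ(∂ₗα, ∂ₗw) = ∂ₗ[F_ρ(α, w)] - (Σᵢ ∂ₗuᵢ ∂ᵢα + ∂ₗρ Σᵢ ∂ᵢwᵢ)` pointwise on `[0, T) × 𝕋³`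
(`∂ₜ∂ₗ = ∂ₗ∂ₜ` one-sided in time, `∂ᵢ∂ₗ = ∂ₗ∂ᵢ`, Leibniz). [folklore] -/
theorem hsEuler_frozen_commutator_density :
    ∀ {σ T : ℝ} {ρ θ : ℝ → T3 → ℝ} {u : ℝ → T3 → V3} {α : ℝ → T3 → ℝ} {w : ℝ → T3 → V3},
    IsHardSphereEulerSolution σ T ρ u θ →
    Torus.IsSmoothSpaceTimeOn (Ico 0 T) α → Torus.IsSmoothSpaceTimeOn (Ico 0 T) w →
    ∀ {t : ℝ}, t ∈ Ico 0 T → ∀ (x : T3) (l : Fin 3),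
    Torus.timeDerivWithin (Ico 0 T) (fun s => Torus.partialDeriv l (α s)) t x +
        ∑ i, u t x i * Torus.partialDeriv i (Torus.partialDeriv l (α t)) x +
        ρ t x * ∑ i, Torus.partialDeriv i (fun y => Torus.partialDeriv l (w t) y i) x =
      Torus.partialDeriv l (fun y => Torus.timeDerivWithin (Ico 0 T) α t y +
          ∑ i, u t y i * Torus.partialDeriv i (α t) y +
          ρ t y * ∑ i, Torus.partialDeriv i (fun z => w t z i) y) x -
        (∑ i, Torus.partialDeriv l (fun y => u t y i) x * Torus.partialDeriv i (α t) x +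
          Torus.partialDeriv l (ρ t) x * ∑ i, Torus.partialDeriv i (fun y => w t y i) x) := by
  intro σ T ρ θ u α w hE hα hw t ht x l
  have hU : UniqueDiffOn ℝ (Ico (0 : ℝ) T) := uniqueDiffOn_Ico 0 T
  -- smooth slices
  have hρ1 : Torus.IsContDiff 1 (ρ t) := (hE.smooth_density.isSmooth_slice ht).isContDiff (by simp)
  have hu1 : Torus.IsContDiff 1 (u t) := (hE.smooth_velocity.isSmooth_slice ht).isContDiff (by simp)
  have huj1 : ∀ i, Torus.IsContDiff 1 (fun y => u t y i) := fun i => isContDiff_apply_coord hu1 i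
  have hαs : Torus.IsSmooth (α t) := hα.isSmooth_slice ht
  have hws : Torus.IsSmooth (w t) := hw.isSmooth_slice ht
  have hwjs : ∀ k, Torus.IsSmooth (fun y => w t y k) := fun k => hws.apply k
  have hαt1 : Torus.IsContDiff 1 (Torus.timeDerivWithin (Ico 0 T) α t) :=
    (hα.isSmooth_timeDerivWithin hU ht).isContDiff (by simp)
  have hDα1 : ∀ k, Torus.IsContDiff 1 (Torus.partialDeriv k (α t)) :=
    fun k => (hαs.partialDeriv k).isContDiff (by simp)
  have hDw1 : ∀ k, Torus.IsContDiff 1 (Torus.partialDeriv k (fun y => w t y k)) :=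
    fun k => ((hwjs k).partialDeriv k).isContDiff (by simp)
  -- (1) exchange the derivatives on the left
  have e1 : Torus.timeDerivWithin (Ico 0 T) (fun s => Torus.partialDeriv l (α s)) t x =
      Torus.partialDeriv l (Torus.timeDerivWithin (Ico 0 T) α t) x :=
    torus_timeDerivWithin_Ico_partialDeriv_comm hα ht l x
  have e3 : ∀ i, Torus.partialDeriv i (fun y => Torus.partialDeriv l (w t) y i) x =
      Torus.partialDeriv l (Torus.partialDeriv i (fun y => w t y i)) x := by
    intro i
    have hfun : (fun y => Torus.partialDeriv l (w t) y i) =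
        Torus.partialDeriv l (fun y => w t y i) :=
      funext fun y => (Torus.partialDeriv_apply_coord (hws.isContDiff (by simp)) l y i).symm
    rw [hfun]
    exact Torus.partialDeriv_comm (hwjs i) i l x
  -- (2) Leibniz along the `l`-th coordinate line on the right
  have cαt := hasDerivAt_coordLine hαt1 x l
  have cu := fun k => hasDerivAt_coordLine (huj1 k) x l
  have cDα := fun k => hasDerivAt_coordLine (hDα1 k) x l
  have cρ := hasDerivAt_coordLine hρ1 x l
  have cDw := fun k => hasDerivAt_coordLine (hDw1 k) x l
  simp only [Fin.sum_univ_three]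
  rw [eq_sub_iff_add_eq]
  refine Eq.symm ((partialDeriv_eq_of_hasDerivAt ((cαt.fun_add ((((cu 0).fun_mul
    (cDα 0)).fun_add ((cu 1).fun_mul (cDα 1))).fun_add ((cu 2).fun_mul (cDα 2)))).fun_add
    (cρ.fun_mul (((cDw 0).fun_add (cDw 1)).fun_add (cDw 2))))).trans ?_)
  simp only [zero_smul, Torus.proj_zero, add_zero]
  rw [e1, Torus.partialDeriv_comm hαs 0 l x, Torus.partialDeriv_comm hαs 1 l x,
    Torus.partialDeriv_comm hαs 2 l x, e3 0, e3 1, e3 2]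
  ring

/-- **One-step commutator, velocity component.** For a classical hard-sphere–Euler solution
`(ρ, u, θ)` on `[0, T) × 𝕋³`, a function `ζ` smooth on an open set `J` containing the values of
`ρ` (`A = θ (ζ(ρ) + ρ ζ'(ρ))/ρ`), jointly smooth fields `α, β` (scalar) and `w` (vector) on
`[0, T) × 𝕋³` and directions `l, j`, the `j`-th velocity component
`F_uⱼ(α, w, β) = ∂ₜwⱼ + Σᵢ uᵢ ∂ᵢwⱼ + A ∂ⱼα + ζ(ρ) ∂ⱼβ` of the frozen-coefficient linearised
operator satisfies
`F_uⱼ(∂ₗα, ∂ₗw, ∂ₗβ) = ∂ₗ[F_uⱼ(α, w, β)] - (Σᵢ ∂ₗuᵢ ∂ᵢwⱼ + ∂ₗA ∂ⱼα + ∂ₗ(ζ(ρ)) ∂ⱼβ)` pointwise on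
`[0, T) × 𝕋³`, where `∂ₗw` is the `V3`-valued partial derivative of the slices (its `j`-th
coordinate is `∂ₗwⱼ`, `Torus.partialDeriv_apply_coord`). [folklore] -/
theorem hsEuler_frozen_commutator_velocity :
    ∀ {σ T : ℝ} {ρ θ : ℝ → T3 → ℝ} {u : ℝ → T3 → V3} {ζ : ℝ → ℝ} {J : Set ℝ}
      {α β : ℝ → T3 → ℝ} {w : ℝ → T3 → V3},
    IsHardSphereEulerSolution σ T ρ u θ → IsOpen J → ContDiffOn ℝ (⊤ : ℕ∞) ζ J →
    (∀ t ∈ Ico 0 T, ∀ x, ρ t x ∈ J) →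
    Torus.IsSmoothSpaceTimeOn (Ico 0 T) α → Torus.IsSmoothSpaceTimeOn (Ico 0 T) w →
    Torus.IsSmoothSpaceTimeOn (Ico 0 T) β →
    ∀ {t : ℝ}, t ∈ Ico 0 T → ∀ (x : T3) (l j : Fin 3),
    Torus.timeDerivWithin (Ico 0 T) (fun s y => Torus.partialDeriv l (w s) y j) t x +
        ∑ i, u t x i * Torus.partialDeriv i (fun y => Torus.partialDeriv l (w t) y j) x +
        θ t x * (ζ (ρ t x) + ρ t x * deriv ζ (ρ t x)) / ρ t x *
          Torus.partialDeriv j (Torus.partialDeriv l (α t)) x +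
        ζ (ρ t x) * Torus.partialDeriv j (Torus.partialDeriv l (β t)) x =
      Torus.partialDeriv l (fun y =>
          Torus.timeDerivWithin (Ico 0 T) (fun s z => w s z j) t y +
            ∑ i, u t y i * Torus.partialDeriv i (fun z => w t z j) y +
            θ t y * (ζ (ρ t y) + ρ t y * deriv ζ (ρ t y)) / ρ t y * Torus.partialDeriv j (α t) y +
            ζ (ρ t y) * Torus.partialDeriv j (β t) y) x -
        (∑ i, Torus.partialDeriv l (fun y => u t y i) x *
            Torus.partialDeriv i (fun y => w t y j) x +
          Torus.partialDeriv l
              (fun y => θ t y * (ζ (ρ t y) + ρ t y * deriv ζ (ρ t y)) / ρ t y) x *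
            Torus.partialDeriv j (α t) x +
          Torus.partialDeriv l (fun y => ζ (ρ t y)) x * Torus.partialDeriv j (β t) x) := by
  intro σ T ρ θ u ζ J α β w hE hJ hζ hρJ hα hw hβ t ht x l j
  have hU : UniqueDiffOn ℝ (Ico (0 : ℝ) T) := uniqueDiffOn_Ico 0 T
  -- smooth slices
  have hρ1 : Torus.IsContDiff 1 (ρ t) := (hE.smooth_density.isSmooth_slice ht).isContDiff (by simp)
  have hu1 : Torus.IsContDiff 1 (u t) := (hE.smooth_velocity.isSmooth_slice ht).isContDiff (by simp)
  have huj1 : ∀ i, Torus.IsContDiff 1 (fun y => u t y i) := fun i => isContDiff_apply_coord hu1 i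
  have hαs : Torus.IsSmooth (α t) := hα.isSmooth_slice ht
  have hβs : Torus.IsSmooth (β t) := hβ.isSmooth_slice ht
  have hws : Torus.IsSmooth (w t) := hw.isSmooth_slice ht
  have hwj : Torus.IsSmoothSpaceTimeOn (Ico 0 T) (fun s y => w s y j) := hw.apply j
  have hwjs : Torus.IsSmooth (fun y => w t y j) := hwj.isSmooth_slice ht
  have hζ1 : Torus.IsContDiff 1 (fun y => ζ (ρ t y)) :=
    (hζ.of_le (by simp)).comp_contDiff hρ1 fun v => hρJ t ht _
  have hA1 : Torus.IsContDiff 1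
      (fun y => θ t y * (ζ (ρ t y) + ρ t y * deriv ζ (ρ t y)) / ρ t y) :=
    ((isSmoothSpaceTimeOn_weightA hE hJ hζ hρJ).isSmooth_slice ht).isContDiff (by simp)
  have hwt1 : Torus.IsContDiff 1 (Torus.timeDerivWithin (Ico 0 T) (fun s y => w s y j) t) :=
    (hwj.isSmooth_timeDerivWithin hU ht).isContDiff (by simp)
  have hDw1 : ∀ k, Torus.IsContDiff 1 (Torus.partialDeriv k (fun y => w t y j)) :=
    fun k => (hwjs.partialDeriv k).isContDiff (by simp)
  have hDα1 : Torus.IsContDiff 1 (Torus.partialDeriv j (α t)) :=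
    (hαs.partialDeriv j).isContDiff (by simp)
  have hDβ1 : Torus.IsContDiff 1 (Torus.partialDeriv j (β t)) :=
    (hβs.partialDeriv j).isContDiff (by simp)
  -- (1) exchange the derivatives on the left
  have hcoord : ∀ s ∈ Ico 0 T, ∀ y,
      Torus.partialDeriv l (w s) y j = Torus.partialDeriv l (fun z => w s z j) y :=
    fun s hs y =>
      (Torus.partialDeriv_apply_coord ((hw.isSmooth_slice hs).isContDiff (by simp)) l y j).symm
  have e1 : Torus.timeDerivWithin (Ico 0 T) (fun s y => Torus.partialDeriv l (w s) y j) t x =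
      Torus.partialDeriv l (Torus.timeDerivWithin (Ico 0 T) (fun s y => w s y j) t) x := by
    have h1 : Torus.timeDerivWithin (Ico 0 T) (fun s y => Torus.partialDeriv l (w s) y j) t x =
        Torus.timeDerivWithin (Ico 0 T) (fun s => Torus.partialDeriv l (fun z => w s z j)) t x := by
      unfold Torus.timeDerivWithin
      exact derivWithin_congr (fun s hs => hcoord s hs x) (hcoord t ht x)
    rw [h1]
    exact torus_timeDerivWithin_Ico_partialDeriv_comm hwj ht l x
  have e2 : ∀ i, Torus.partialDeriv i (fun y => Torus.partialDeriv l (w t) y j) x =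
      Torus.partialDeriv l (Torus.partialDeriv i (fun z => w t z j)) x := by
    intro i
    have hfun : (fun y => Torus.partialDeriv l (w t) y j) =
        Torus.partialDeriv l (fun z => w t z j) :=
      funext fun y => hcoord t ht y
    rw [hfun]
    exact Torus.partialDeriv_comm hwjs i l x
  -- (2) Leibniz along the `l`-th coordinate line on the right
  have cwt := hasDerivAt_coordLine hwt1 x l
  have cu := fun k => hasDerivAt_coordLine (huj1 k) x l
  have cDw := fun k => hasDerivAt_coordLine (hDw1 k) x l
  have cA := hasDerivAt_coordLine hA1 x l
  have cDα := hasDerivAt_coordLine hDα1 x l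
  have cζ := hasDerivAt_coordLine hζ1 x l
  have cDβ := hasDerivAt_coordLine hDβ1 x l
  simp only [Fin.sum_univ_three]
  rw [eq_sub_iff_add_eq]
  refine Eq.symm ((partialDeriv_eq_of_hasDerivAt (((cwt.fun_add ((((cu 0).fun_mul
    (cDw 0)).fun_add ((cu 1).fun_mul (cDw 1))).fun_add ((cu 2).fun_mul (cDw 2)))).fun_add
    (cA.fun_mul cDα)).fun_add (cζ.fun_mul cDβ))).trans ?_)
  simp only [zero_smul, Torus.proj_zero, add_zero]
  rw [e1, e2 0, e2 1, e2 2, Torus.partialDeriv_comm hαs j l x, Torus.partialDeriv_comm hβs j l x]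
  ring

/-- **One-step commutator, temperature component.** For a classical hard-sphere–Euler solution
`(ρ, u, θ)` on `[0, T) × 𝕋³`, a function `ζ` smooth on a set `J` containing the values of `ρ`,
jointly smooth fields `β` (scalar) and `w` (vector) on `[0, T) × 𝕋³` and a direction `l`, the
temperature component `F_θ(w, β) = ∂ₜβ + Σᵢ uᵢ ∂ᵢβ + (2/3) θ ζ(ρ) Σᵢ ∂ᵢwᵢ` of the
frozen-coefficient linearised operator satisfies
`F_θ(∂ₗw, ∂ₗβ) = ∂ₗ[F_θ(w, β)] - (Σᵢ ∂ₗuᵢ ∂ᵢβ + (2/3) ∂ₗ(θ ζ(ρ)) Σᵢ ∂ᵢwᵢ)` pointwise on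
`[0, T) × 𝕋³`. [folklore] -/
theorem hsEuler_frozen_commutator_temperature :
    ∀ {σ T : ℝ} {ρ θ : ℝ → T3 → ℝ} {u : ℝ → T3 → V3} {ζ : ℝ → ℝ} {J : Set ℝ}
      {β : ℝ → T3 → ℝ} {w : ℝ → T3 → V3},
    IsHardSphereEulerSolution σ T ρ u θ → ContDiffOn ℝ (⊤ : ℕ∞) ζ J →
    (∀ t ∈ Ico 0 T, ∀ x, ρ t x ∈ J) →
    Torus.IsSmoothSpaceTimeOn (Ico 0 T) w → Torus.IsSmoothSpaceTimeOn (Ico 0 T) β →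
    ∀ {t : ℝ}, t ∈ Ico 0 T → ∀ (x : T3) (l : Fin 3),
    Torus.timeDerivWithin (Ico 0 T) (fun s => Torus.partialDeriv l (β s)) t x +
        ∑ i, u t x i * Torus.partialDeriv i (Torus.partialDeriv l (β t)) x +
        2 / 3 * (θ t x * ζ (ρ t x)) *
          ∑ i, Torus.partialDeriv i (fun y => Torus.partialDeriv l (w t) y i) x =
      Torus.partialDeriv l (fun y => Torus.timeDerivWithin (Ico 0 T) β t y +
          ∑ i, u t y i * Torus.partialDeriv i (β t) y +
          2 / 3 * (θ t y * ζ (ρ t y)) * ∑ i, Torus.partialDeriv i (fun z => w t z i) y) x -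
        (∑ i, Torus.partialDeriv l (fun y => u t y i) x * Torus.partialDeriv i (β t) x +
          2 / 3 * Torus.partialDeriv l (fun y => θ t y * ζ (ρ t y)) x *
            ∑ i, Torus.partialDeriv i (fun y => w t y i) x) := by
  intro σ T ρ θ u ζ J β w hE hζ hρJ hw hβ t ht x l
  have hU : UniqueDiffOn ℝ (Ico (0 : ℝ) T) := uniqueDiffOn_Ico 0 T
  -- smooth slices
  have hρ1 : Torus.IsContDiff 1 (ρ t) := (hE.smooth_density.isSmooth_slice ht).isContDiff (by simp)
  have hθ1 : Torus.IsContDiff 1 (θ t) :=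
    (hE.smooth_temperature.isSmooth_slice ht).isContDiff (by simp)
  have hu1 : Torus.IsContDiff 1 (u t) := (hE.smooth_velocity.isSmooth_slice ht).isContDiff (by simp)
  have huj1 : ∀ i, Torus.IsContDiff 1 (fun y => u t y i) := fun i => isContDiff_apply_coord hu1 i
  have hβs : Torus.IsSmooth (β t) := hβ.isSmooth_slice ht
  have hws : Torus.IsSmooth (w t) := hw.isSmooth_slice ht
  have hwjs : ∀ k, Torus.IsSmooth (fun y => w t y k) := fun k => hws.apply k
  have hζ1 : Torus.IsContDiff 1 (fun y => ζ (ρ t y)) :=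
    (hζ.of_le (by simp)).comp_contDiff hρ1 fun v => hρJ t ht _
  have hph1 : Torus.IsContDiff 1 (fun y => θ t y * ζ (ρ t y)) := (hθ1.mul hζ1 :)
  have hβt1 : Torus.IsContDiff 1 (Torus.timeDerivWithin (Ico 0 T) β t) :=
    (hβ.isSmooth_timeDerivWithin hU ht).isContDiff (by simp)
  have hDβ1 : ∀ k, Torus.IsContDiff 1 (Torus.partialDeriv k (β t)) :=
    fun k => (hβs.partialDeriv k).isContDiff (by simp)
  have hDw1 : ∀ k, Torus.IsContDiff 1 (Torus.partialDeriv k (fun y => w t y k)) :=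
    fun k => ((hwjs k).partialDeriv k).isContDiff (by simp)
  -- (1) exchange the derivatives on the left
  have e1 : Torus.timeDerivWithin (Ico 0 T) (fun s => Torus.partialDeriv l (β s)) t x =
      Torus.partialDeriv l (Torus.timeDerivWithin (Ico 0 T) β t) x :=
    torus_timeDerivWithin_Ico_partialDeriv_comm hβ ht l x
  have e3 : ∀ i, Torus.partialDeriv i (fun y => Torus.partialDeriv l (w t) y i) x =
      Torus.partialDeriv l (Torus.partialDeriv i (fun y => w t y i)) x := by
    intro i
    have hfun : (fun y => Torus.partialDeriv l (w t) y i) =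
        Torus.partialDeriv l (fun y => w t y i) :=
      funext fun y => (Torus.partialDeriv_apply_coord (hws.isContDiff (by simp)) l y i).symm
    rw [hfun]
    exact Torus.partialDeriv_comm (hwjs i) i l x
  -- (2) Leibniz along the `l`-th coordinate line on the right
  have cβt := hasDerivAt_coordLine hβt1 x l
  have cu := fun k => hasDerivAt_coordLine (huj1 k) x l
  have cDβ := fun k => hasDerivAt_coordLine (hDβ1 k) x l
  have cph := hasDerivAt_coordLine hph1 x l
  have cDw := fun k => hasDerivAt_coordLine (hDw1 k) x l
  simp only [Fin.sum_univ_three]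
  rw [eq_sub_iff_add_eq]
  refine Eq.symm ((partialDeriv_eq_of_hasDerivAt ((cβt.fun_add ((((cu 0).fun_mul
    (cDβ 0)).fun_add ((cu 1).fun_mul (cDβ 1))).fun_add ((cu 2).fun_mul (cDβ 2)))).fun_add
    ((cph.const_mul (2 / 3)).fun_mul (((cDw 0).fun_add (cDw 1)).fun_add (cDw 2))))).trans ?_)
  simp only [zero_smul, Torus.proj_zero, add_zero]
  rw [e1, Torus.partialDeriv_comm hβs 0 l x, Torus.partialDeriv_comm hβs 1 l x,
    Torus.partialDeriv_comm hβs 2 l x, e3 0, e3 1, e3 2]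
  ring

end Commutator

end Summit.AtomisticToContinuum.HydrodynamicLimit.Theorems

end
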